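import Literature.NumberTheory.Automorphic.UpqKInLieTorusConjugation     -- ★-to-be (A-p06 (g24)): T4b-i `exists_Ad_torusGen_eq_of_mem_kInLie`
import Literature.NumberTheory.Automorphic.InfUnitaryHilbertCompletion   -- ★ G0 (A-p14 (g24)): `IsPosDefHerm`, `emb`, `norm_emb_sq`
import HarnessLib

/-!
# The K-BOUND: `‖ρ𝔤(Y) u‖ ≤ (|α|+|β|) · ‖Y‖ · R · ‖u‖` on a `K`-stable subspace, from the torus bound, for every `Y ∈ 𝔨`

Topic `NumberTheory/Automorphic`; namespace `Literature.NumberTheory.Automorphic`; THEOREMS ONLY (no `def`, no named fact, no instance declaration, no notation,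
no `sorry`).  Cell `hodgecm-mathlib`, F0∕P3, T1a arch line, ROAD-GLOB (A6 #92 at `U(2,1)`), brick «FB», piece **T4b-ii** (module side of the K-BOUND,
A-p06 (g24) plan 2026-08-31).  Data: a `(𝔤, K)`-module `(ρK, ρ𝔤)` of `U(α, β)` (★ `IsGKModule`), a positive definite Hermitian form `B` (★ G0 `IsPosDefHerm`,
norms `‖·‖ := ‖emb ·‖ = √(Re B · ·)`) for which `K` acts by isometries, and a `K`-stable subspace `U` (a level `F n` of the `𝔭`-filtration) on which every BASIS
torus generator `t_j = torusGen e_j 0`, `t'_l = torusGen 0 e_l` satisfies `‖ρ𝔤(t) u‖ ≤ R ‖u‖` (★ T1∕T2∕T3: `R = r₀ + n`).  THEN for every `Y ∈ 𝔨`: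
**`‖emb (ρ𝔤 Y u)‖ ≤ (|α| + |β|) · ‖Y‖ · R · ‖emb u‖`** (`‖Y‖` the `L^∞`-operator norm of ★ `GKModules` (H3)) — because `Y = Ad(k) (Σ a_j t_j + Σ b_l t'_l)` with
`k ∈ K`, `|a_j|, |b_l| ≤ ‖Y‖` (★ T4b-i), `ρ𝔤(Ad k t) = ρK(k) ρ𝔤(t) ρK(k)⁻¹` (★ `IsGKModule.ad_compat`) and `ρK(k)` is an isometry preserving `U`.
[Knapp2002, IV §4 Thm. 4.34]; [HarishChandra1953, §9]; [KnappVogan1995, Thm. 0.6].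
HONEST LABEL: closes no registered stub by itself.  HC_CM is proved only modulo the 2 remaining named inputs (hLiu418, h413) until rung 0 closes.

## References
* A. W. Knapp, *Lie Groups Beyond an Introduction*, 2nd ed. (2002), IV §4 Thm. 4.34 [Knapp2002].
* Harish-Chandra, *Representations of a semisimple Lie group on a Banach space. I*, Trans. AMS 75 (1953), §9 [HarishChandra1953].
* A. W. Knapp, D. A. Vogan, *Cohomological Induction and Unitary Representations* (1995), Thm. 0.6 [KnappVogan1995].
-/

-- Mathlib idiom (as in ★ `GKModules`): the commutator bracket on `Module.End ℂ V`, to MENTION `ρ𝔤 : 𝔤 →ₗ⁅ℝ⁆ End V`.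
attribute [local instance 100] LieRing.ofAssociativeRing

set_option autoImplicit false

noncomputable section

namespace Literature.NumberTheory.Automorphic

open scoped Matrix ComplexConjugate Matrix.Norms.Operator
open Literature.RepresentationTheory.KonnoKonno2007 Literature.RepresentationTheory.KonnoKonno2007.RealDualPair
open Literature.RepresentationTheory.BorelWallach2000

variable {α β : Type} [Fintype α] [DecidableEq α] [Fintype β] [DecidableEq β]
variable {V : Type*} [AddCommGroup V] [Module ℂ V]
  (ρK : Representation ℂ (uFormGroup α β).maximalCompact V) (ρ𝔤 : (uFormGroup α β).lie →ₗ⁅ℝ⁆ Module.End ℂ V)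

/-! ## §1 Torus generators are linear in their rates -/

/-- `torusGen a b = Σ_j a_j · torusGen e_j 0 + Σ_l b_l · torusGen 0 e_l` in `𝔤`. [cite: BorelWallach2000, II §1.1 (5)] -/
theorem torusGen_eq_sum_single (a : α → ℝ) (b : β → ℝ) :
    (⟨torusGen a b, torusGen_mem_lie a b⟩ : (uFormGroup α β).lie) =
      ∑ j, a j • (⟨torusGen (Pi.single j 1) 0, torusGen_mem_lie _ _⟩ : (uFormGroup α β).lie) +
        ∑ l, b l • (⟨torusGen 0 (Pi.single l 1), torusGen_mem_lie _ _⟩ : (uFormGroup α β).lie) := by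
  apply Subtype.ext
  rw [AddMemClass.coe_add, AddSubmonoidClass.coe_finsetSum, AddSubmonoidClass.coe_finsetSum]
  simp only [SetLike.val_smul]
  change torusGen a b = ∑ j, a j • torusGen (Pi.single j (1 : ℝ)) (0 : β → ℝ) + ∑ l, b l • torusGen (0 : α → ℝ) (Pi.single l (1 : ℝ))
  ext x y
  simp only [Matrix.add_apply, Matrix.sum_apply, Matrix.smul_apply, torusGen_apply]
  by_cases hxy : x = y
  · subst hxy
    simp only [if_true]
    rcases x with j | l
    · simp only [Sum.elim_inl, Pi.zero_apply, Complex.ofReal_zero, zero_mul, neg_zero, smul_zero,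
        Finset.sum_const_zero, add_zero, Pi.single_apply]
      rw [Finset.sum_eq_single j]
      · simp [Complex.real_smul]
      · intro k _ hkj
        simp [Ne.symm hkj]
      · intro h; exact absurd (Finset.mem_univ j) h
    · simp only [Sum.elim_inr, Pi.zero_apply, Complex.ofReal_zero, zero_mul, neg_zero, smul_zero,
        Finset.sum_const_zero, zero_add, Pi.single_apply]
      rw [Finset.sum_eq_single l]
      · simp [Complex.real_smul]
      · intro k _ hkl
        simp [Ne.symm hkl]
      · intro h; exact absurd (Finset.mem_univ l) h
  · simp [hxy]

/-! ## §2 Norm bookkeeping in the pre-Hilbert structure of `B` -/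

section Norms

variable {B : V →ₗ⋆[ℂ] V →ₗ[ℂ] ℂ} (hB : IsPosDefHerm B)
include hB

/-- `K`-isometry read on `‖emb ·‖`: `B (ρK k x) (ρK k y) = B x y` ⇒ `‖emb (ρK k x)‖ = ‖emb x‖`. [cite: KnappVogan1995, Thm. 0.6] -/
theorem norm_emb_ρK_apply (hKu : ∀ (k : (uFormGroup α β).maximalCompact) (x y : V), B (ρK k x) (ρK k y) = B x y)
    (k : (uFormGroup α β).maximalCompact) (x : V) : ‖hB.emb (ρK k x)‖ = ‖hB.emb x‖ := by
  have h1 := hB.norm_emb_sq (ρK k x)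
  have h2 := hB.norm_emb_sq x
  rw [hKu] at h1
  nlinarith [norm_nonneg (hB.emb (ρK k x)), norm_nonneg (hB.emb x), h1, h2, sq_nonneg (‖hB.emb (ρK k x)‖ - ‖hB.emb x‖),
    sq_nonneg (‖hB.emb (ρK k x)‖ + ‖hB.emb x‖)]

/-- Real scalars through `emb`: `‖emb (ρ𝔤 (c • X) v)‖ = |c| · ‖emb (ρ𝔤 X v)‖`. [cite: KnappVogan1995, Thm. 0.6] -/
theorem norm_emb_ρ𝔤_smul (c : ℝ) (X : (uFormGroup α β).lie) (v : V) :
    ‖hB.emb (ρ𝔤 (c • X) v)‖ = |c| * ‖hB.emb (ρ𝔤 X v)‖ := by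
  rw [map_smul]
  have h : ((c • ρ𝔤 X) v : V) = (c : ℂ) • ρ𝔤 X v := by
    rw [LinearMap.smul_apply]; rfl
  rw [h, map_smul, norm_smul, Complex.norm_real, Real.norm_eq_abs]

/-- Triangle inequality for a finite sum through `emb`: `‖emb (ρ𝔤 (Σ c_j X_j) v)‖ ≤ Σ |c_j| ‖emb (ρ𝔤 X_j v)‖`. [cite: KnappVogan1995, Thm. 0.6] -/
theorem norm_emb_ρ𝔤_sum_smul_le {ι : Type*} (s : Finset ι) (c : ι → ℝ) (X : ι → (uFormGroup α β).lie) (v : V) :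
    ‖hB.emb (ρ𝔤 (∑ i ∈ s, c i • X i) v)‖ ≤ ∑ i ∈ s, |c i| * ‖hB.emb (ρ𝔤 (X i) v)‖ := by
  rw [map_sum, LinearMap.sum_apply, map_sum]
  refine (norm_sum_le _ _).trans (le_of_eq (Finset.sum_congr rfl fun i _ => ?_))
  exact norm_emb_ρ𝔤_smul ρ𝔤 hB (c i) (X i) v

end Norms

/-! ## §3 The K-BOUND -/

/-- **T4b-ii — THE K-BOUND.**  `(ρK, ρ𝔤)` a `(𝔤, K)`-module of `U(α, β)`, `B` positive definite Hermitian with `K` acting by `B`-isometries, `U` a `K`-stable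
subspace on which the basis torus generators satisfy `‖emb (ρ𝔤 t u)‖ ≤ R ‖emb u‖`.  Then for every `Y ∈ 𝔨` and `u ∈ U`:
`‖emb (ρ𝔤 Y u)‖ ≤ (|α| + |β|) · ‖Y‖ · R · ‖emb u‖`. [cite: Knapp2002, IV §4 Thm. 4.34] [cite: HarishChandra1953, §9] [cite: KnappVogan1995, Thm. 0.6] -/
theorem norm_emb_ρ𝔤_le_of_mem_kInLie [Nonempty α] [Nonempty β] (hV : IsGKModule (uFormGroup α β) ρK ρ𝔤)
    {B : V →ₗ⋆[ℂ] V →ₗ[ℂ] ℂ} (hB : IsPosDefHerm B)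
    (hKu : ∀ (k : (uFormGroup α β).maximalCompact) (x y : V), B (ρK k x) (ρK k y) = B x y)
    {U : Submodule ℂ V} (hU : ∀ (k : (uFormGroup α β).maximalCompact), ∀ u ∈ U, ρK k u ∈ U) {R : ℝ}
    (hα : ∀ j : α, ∀ u ∈ U, ‖hB.emb (ρ𝔤 ⟨torusGen (Pi.single j 1) 0, torusGen_mem_lie _ _⟩ u)‖ ≤ R * ‖hB.emb u‖)
    (hβ : ∀ l : β, ∀ u ∈ U, ‖hB.emb (ρ𝔤 ⟨torusGen 0 (Pi.single l 1), torusGen_mem_lie _ _⟩ u)‖ ≤ R * ‖hB.emb u‖)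
    (Y : (uFormGroup α β).lie) (hY : Y ∈ (uFormGroup α β).kInLie) {u : V} (hu : u ∈ U) :
    ‖hB.emb (ρ𝔤 Y u)‖ ≤ (Fintype.card α + Fintype.card β) * ‖(Y : Matrix (α ⊕ β) (α ⊕ β) ℂ)‖ * R * ‖hB.emb u‖ := by
  obtain ⟨U₁, U₂, a, b, hAd, ha, hb⟩ := exists_Ad_torusGen_eq_of_mem_kInLie Y hY
  set k : (uFormGroup α β).maximalCompact := upqMaximalCompactEquiv.symm (U₁, U₂) with hk
  set t : (uFormGroup α β).lie := ⟨torusGen a b, torusGen_mem_lie a b⟩ with ht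
  -- `ρ𝔤 Y u = ρK k (ρ𝔤 t (ρK k⁻¹ u))`
  set v := ρK k⁻¹ u with hv
  have hvU : v ∈ U := hU k⁻¹ u hu
  have hkv : ρK k v = u := by
    rw [hv, ← Module.End.mul_apply, ← map_mul, mul_inv_cancel, map_one, Module.End.one_apply]
  have hconj : ρ𝔤 Y u = ρK k (ρ𝔤 t v) := by
    have h := LinearMap.congr_fun (hV.ad_compat k t) u
    simp only [LinearMap.coe_comp, Function.comp_apply] at h
    rw [← hAd, ← h]
  rw [hconj, norm_emb_ρK_apply ρK hB hKu k]
  -- `t = Σ a_j t_j + Σ b_l t'_l` and the triangle inequality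
  rw [ht, torusGen_eq_sum_single, map_add, LinearMap.add_apply, map_add]
  have hnorm_u : ‖hB.emb v‖ = ‖hB.emb u‖ := by rw [← hkv, norm_emb_ρK_apply ρK hB hKu k]
  have hY0 : 0 ≤ ‖(Y : Matrix (α ⊕ β) (α ⊕ β) ℂ)‖ := norm_nonneg _
  have h1 : ‖hB.emb (ρ𝔤 (∑ j, a j • (⟨torusGen (Pi.single j 1) 0, torusGen_mem_lie _ _⟩ : (uFormGroup α β).lie)) v)‖ ≤
      Fintype.card α * ‖(Y : Matrix (α ⊕ β) (α ⊕ β) ℂ)‖ * R * ‖hB.emb u‖ := by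
    refine (norm_emb_ρ𝔤_sum_smul_le ρ𝔤 hB Finset.univ a _ v).trans ?_
    calc ∑ j, |a j| * ‖hB.emb (ρ𝔤 ⟨torusGen (Pi.single j 1) 0, torusGen_mem_lie _ _⟩ v)‖
        ≤ ∑ _j : α, ‖(Y : Matrix (α ⊕ β) (α ⊕ β) ℂ)‖ * (R * ‖hB.emb u‖) :=
          Finset.sum_le_sum fun j _ => mul_le_mul (ha j) (hnorm_u ▸ hα j v hvU) (norm_nonneg _) hY0
      _ = Fintype.card α * ‖(Y : Matrix (α ⊕ β) (α ⊕ β) ℂ)‖ * R * ‖hB.emb u‖ := by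
          rw [Finset.sum_const, Finset.card_univ, nsmul_eq_mul]; ring
  have h2 : ‖hB.emb (ρ𝔤 (∑ l, b l • (⟨torusGen 0 (Pi.single l 1), torusGen_mem_lie _ _⟩ : (uFormGroup α β).lie)) v)‖ ≤
      Fintype.card β * ‖(Y : Matrix (α ⊕ β) (α ⊕ β) ℂ)‖ * R * ‖hB.emb u‖ := by
    refine (norm_emb_ρ𝔤_sum_smul_le ρ𝔤 hB Finset.univ b _ v).trans ?_
    calc ∑ l, |b l| * ‖hB.emb (ρ𝔤 ⟨torusGen 0 (Pi.single l 1), torusGen_mem_lie _ _⟩ v)‖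
        ≤ ∑ _l : β, ‖(Y : Matrix (α ⊕ β) (α ⊕ β) ℂ)‖ * (R * ‖hB.emb u‖) :=
          Finset.sum_le_sum fun l _ => mul_le_mul (hb l) (hnorm_u ▸ hβ l v hvU) (norm_nonneg _) hY0
      _ = Fintype.card β * ‖(Y : Matrix (α ⊕ β) (α ⊕ β) ℂ)‖ * R * ‖hB.emb u‖ := by
          rw [Finset.sum_const, Finset.card_univ, nsmul_eq_mul]; ring
  calc ‖hB.emb (ρ𝔤 (∑ j, a j • (⟨torusGen (Pi.single j 1) 0, torusGen_mem_lie _ _⟩ : (uFormGroup α β).lie)) v) +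
          hB.emb (ρ𝔤 (∑ l, b l • (⟨torusGen 0 (Pi.single l 1), torusGen_mem_lie _ _⟩ : (uFormGroup α β).lie)) v)‖
      ≤ _ := norm_add_le _ _
    _ ≤ Fintype.card α * ‖(Y : Matrix (α ⊕ β) (α ⊕ β) ℂ)‖ * R * ‖hB.emb u‖ +
          Fintype.card β * ‖(Y : Matrix (α ⊕ β) (α ⊕ β) ℂ)‖ * R * ‖hB.emb u‖ := add_le_add h1 h2
    _ = (Fintype.card α + Fintype.card β) * ‖(Y : Matrix (α ⊕ β) (α ⊕ β) ℂ)‖ * R * ‖hB.emb u‖ := by ring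

end Literature.NumberTheory.Automorphic

end
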